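import Mathlib
import Summits.NavierStokesRegularity.NavierStokesRegularity.Theorems.FilamentSkeletonRssStadiumContourFreeze
import Summits.NavierStokesRegularity.NavierStokesRegularity.Theorems.FilamentSkeletonRssStadiumFrozenPieces
import Summits.NavierStokesRegularity.NavierStokesRegularity.Theorems.FilamentSkeletonRssStadiumOwnFarPiece

/-!
# The continued OWN-filament field of the retyped contour is holomorphic on the output stadium (`TangentSkeletonNearStraightL`,
# stmt-NavierStokesRegularity-23320, registered stub `stub_stripPropagation` — blueprint item R4′ of `DIAG-addendum2-landed-g2.md`, COMPLETE)

Concrete geometry (`16h ≤ hs`, `S₁₆ = {|Im| < h, |Re − c| < L + h}`, `P = L + 8h`, ratio 8, `M = 2`, `0 ≤ Rb ≤ 1/2`).  The own-filament field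
  `U(z) = ∫_{P ≤ |σ−c|} K_X(z, σ) dσ + [∫_{c−P}^{c+P} K(z, σ+i·Im z) dσ − i•∫_0^{Im z} K(z, c+P+is) ds + i•∫_0^{Im z} K(z, c−P+is) ds]`
(real sources `X σ` far out, `F`-sources on plateau and connectors, `K` the complexified matched kernel with the core continuation `G`, `K_X` with the real core
`κA(σ)`) is holomorphic on `S₁₆` (`own_contour_differentiableOn`): Theorems.StadiumContourFamily.differentiableOn_of_height_family with `hfreeze` =
Theorems.StadiumContourFreeze.contour_freeze and `hdiff` = Theorems.StadiumOwnFarPiece.ownFarPiece_differentiableOn +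
Theorems.StadiumFrozenPieces.frozen_differentiableAt.  What is left for the retyped stub: R5′ partners' sum (done per summand), R6′ collecting the bound
(PlateauBound + ConnectorBound + OwnFarPiece + PartnerPiece), R7′ the assembly into the retyped text.  HONEST FRAMING: a tool for a HYPOTHETICAL filament
skeleton on the NEGATIVE side of a MODEL route; nothing here bears on Navier–Stokes regularity or blow-up.  `--supports stmt-NavierStokesRegularity-23320`.
-/

set_option linter.dupNamespace false

noncomputable section

namespace Summit.NavierStokesRegularity.NavierStokesRegularity.Theorems.StadiumOwnContourHolo

open Set Metric MeasureTheory Complex Filter Topology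
open scoped InnerProductSpace Matrix
open Summit.NavierStokesRegularity.NavierStokesRegularity.Theorems.StadiumContourFamily
open Summit.NavierStokesRegularity.NavierStokesRegularity.Theorems.StadiumContourFreeze
open Summit.NavierStokesRegularity.NavierStokesRegularity.Theorems.StadiumFrozenPieces
open Summit.NavierStokesRegularity.NavierStokesRegularity.Theorems.StadiumOwnFarPiece
open Summit.NavierStokesRegularity.NavierStokesRegularity.Theorems.StadiumPartnerPiece

/-- **The continued own-filament field is holomorphic on `S₁₆`.**  See the module docstring. [folklore] -/
theorem own_contour_differentiableOn {hs L cc Rb h κ Λ : ℝ} {F : ℂ → (Fin 3 → ℂ)} {G : ℂ → ℂ} {A : ℝ → ℝ}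
    (hF : DifferentiableOn ℂ F {z : ℂ | |z.im| < hs ∧ |z.re - cc| < L + hs})
    (hunit : ∀ w ∈ {z : ℂ | |z.im| < hs ∧ |z.re - cc| < L + hs}, ∑ i, (deriv F w i) ^ 2 = 1)
    (hM : ∀ z ∈ {z : ℂ | |z.im| < hs ∧ |z.re - cc| < L + hs}, ‖deriv F z‖ ≤ 2)
    {X : ℝ → EuclideanSpace ℝ (Fin 3)} (hX : ContDiff ℝ 1 X) (hXu : ∀ τ, ‖deriv X τ‖ = 1)
    (hRb0 : 0 ≤ Rb) (hRb : Rb ≤ 1 / 2) (hosc : ∀ τ σ, ‖deriv X τ - deriv X σ‖ ≤ Rb)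
    (hFX : ∀ r : ℝ, (r : ℂ) ∈ {z : ℂ | |z.im| < hs ∧ |z.re - cc| < L + hs} →
      F r = fun i => ((⟪X r, EuclideanSpace.single i (1:ℝ)⟫_ℝ : ℝ) : ℂ))
    (hG : DifferentiableOn ℂ G {z : ℂ | |z.im| < hs ∧ |z.re - cc| < L + hs})
    (hGre : ∀ w ∈ {z : ℂ | |z.im| < hs ∧ |z.re - cc| < L + hs}, Λ⁻¹ / 2 ≤ (G w).re)
    (hAc : Continuous A) (hA : ∀ σ, 0 ≤ A σ)
    (hκ : 0 < κ) (hΛ : 0 < Λ) (hh : 0 < h) (h16 : 16 * h ≤ hs) (hL : 0 ≤ L) :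
    let K : ℂ → ℂ → (Fin 3 → ℂ) := fun z ζ => (((∑ i, (F z i - F ζ i) ^ 2) + (κ : ℂ) * G ζ) ^ ((3:ℂ) / 2))⁻¹ •
        (deriv F ζ ⨯₃ (fun i => F z i - F ζ i))
    DifferentiableOn ℂ (fun z =>
      (∫ σ in {σ : ℝ | L + 8 * h ≤ |σ - cc|},
        (((∑ i, (F z i - ((X σ i : ℝ) : ℂ)) ^ 2) + ((κ * A σ : ℝ) : ℂ)) ^ ((3:ℂ) / 2))⁻¹ •
          ((fun i => ((deriv X σ i : ℝ) : ℂ)) ⨯₃ (fun i => F z i - ((X σ i : ℝ) : ℂ)))) +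
      ((∫ σ in (cc - (L + 8 * h))..(cc + (L + 8 * h)), K z ((σ : ℂ) + (z.im : ℂ) * I)) -
        I • (∫ s in (0:ℝ)..z.im, K z (((cc + (L + 8 * h) : ℝ) : ℂ) + (s : ℂ) * I)) +
        I • (∫ s in (0:ℝ)..z.im, K z (((cc - (L + 8 * h) : ℝ) : ℂ) + (s : ℂ) * I))))
      {z : ℂ | |z.im| < h ∧ |z.re - cc| < L + h} := by
  intro K
  have hXd : Differentiable ℝ X := hX.differentiable (by simp)
  have hosc2 : ∀ τ σ, ‖deriv X τ - deriv X σ‖ ≤ 1 / 2 := fun τ σ => (hosc τ σ).trans hRb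
  have hS16o : IsOpen {z : ℂ | |z.im| < h ∧ |z.re - cc| < L + h} := isOpen_stadium h (L + h) cc
  -- the far piece on `S₁₆` (`hs' := h`, `9h ≤ 16h ≤ hs`)
  have hFar := ownFarPiece_differentiableOn (hs' := h) hF hM hX hXu hosc2 hFX hAc hA hκ.le hh (by linarith)
  -- radii for freezing
  set ρ : ℝ := Real.sqrt (κ * Λ⁻¹ / 48) with hρ
  have hρpos : 0 < ρ := Real.sqrt_pos.2 (by positivity)
  have hρ2 : ρ ^ 2 = κ * Λ⁻¹ / 48 := Real.sq_sqrt (by positivity)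
  have hsmall : 3 * (2:ℝ) ^ 2 * (ρ / 2 + ρ / 7) ^ 2 ≤ κ * Λ⁻¹ / 4 := by nlinarith [hρ2]
  refine differentiableOn_of_height_family
    (R := fun z => ∫ σ in {σ : ℝ | L + 8 * h ≤ |σ - cc|},
        (((∑ i, (F z i - ((X σ i : ℝ) : ℂ)) ^ 2) + ((κ * A σ : ℝ) : ℂ)) ^ ((3:ℂ) / 2))⁻¹ •
          ((fun i => ((deriv X σ i : ℝ) : ℂ)) ⨯₃ (fun i => F z i - ((X σ i : ℝ) : ℂ))))
    (Φ := fun y z => (∫ σ in (cc - (L + 8 * h))..(cc + (L + 8 * h)), K z ((σ : ℂ) + (y : ℂ) * I)) -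
        I • (∫ s in (0:ℝ)..y, K z (((cc + (L + 8 * h) : ℝ) : ℂ) + (s : ℂ) * I)) +
        I • (∫ s in (0:ℝ)..y, K z (((cc - (L + 8 * h) : ℝ) : ℂ) + (s : ℂ) * I))) ?_ ?_
  · -- freezing the height near `z₀`
    intro z₀ hz₀
    refine ⟨{z : ℂ | |z.im| < h ∧ |z.re - cc| < L + h} ∩ ball z₀ (ρ / 7), inter_mem (hS16o.mem_nhds hz₀) (ball_mem_nhds z₀ (by positivity)), ?_⟩
    intro z hz
    have hzS16 := hz.1
    have hδ : |z.im - z₀.im| < ρ / 7 := by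
      have h1 := hz.2; rw [mem_ball, dist_eq_norm] at h1
      exact lt_of_le_of_lt (by simpa using Complex.abs_im_le_norm (z - z₀)) h1
    have h := contour_freeze hF hunit hM hXd hXu hRb0 hRb hosc hFX hG hGre hκ hΛ hh h16 hL hz₀ hzS16 (r₀ := ρ / 2) (by positivity) hδ
      (by linarith) hsmall
    exact h.symm
  · -- differentiability of the frozen expression at `z₀`
    intro z₀ hz₀
    have h1 : DifferentiableAt ℂ (fun z => ∫ σ in {σ : ℝ | L + 8 * h ≤ |σ - cc|},
        (((∑ i, (F z i - ((X σ i : ℝ) : ℂ)) ^ 2) + ((κ * A σ : ℝ) : ℂ)) ^ ((3:ℂ) / 2))⁻¹ •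
          ((fun i => ((deriv X σ i : ℝ) : ℂ)) ⨯₃ (fun i => F z i - ((X σ i : ℝ) : ℂ)))) z₀ :=
      hFar.differentiableAt (hS16o.mem_nhds hz₀)
    have h2 := frozen_differentiableAt hF hunit hM hXd hXu hRb0 hRb hosc hFX hG hGre hκ hΛ hh h16 hL hz₀
    exact h1.add h2

end Summit.NavierStokesRegularity.NavierStokesRegularity.Theorems.StadiumOwnContourHolo

end
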